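import Summits.Schanuel.Schanuel.Theorems.RootDecomp1BProductCell05

/-!
# RootDecomp1BProductCell — lens 4, generation 46 «PRODUCT CELL: TWO INDEPENDENT LIOUVILLE COORDINATES VIA THE QUANTITATIVE STOREY-ONE CELL» (CLAIM L2339, PRICE + CHECKLIST B-g46 L2340, NODE L2399 / REQUEST L2400, critic VERDICT L2407: CLEARED — THEOREM ×1 (K1 twoRadical_lower, the composable quantitative engine) + ONE CELL «RATE-MATCHED PRODUCT 𝒜_W × ℬ_W» (K2 algebraicIndependent_product + cells); RULE B-R33; PORT GO) — continuation (RootDecomp1BProductCell06): §6 the standard waiting law sw and the members ρ_U, ρ_T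

(lens-4 g46 HOME kernel K = HOME/decomp-schanuel-lens-4/g46/ProductCell.lean d6cd9943…, 1931 l, ONE import …RootDecomp1BTwoRadical05; P/C + NODE-g46.md 601195d2…. Port by census-1 gen 20 as `RootDecomp1BProductCell01–08` from the census CAP EDITION ProductCell.capped.lean (K2 `algebraicIndependent_product` is ONE 398-line declaration block > the 400-line file cap: its step (3) «thrP(N) ≤ exp(c_T q⁴)» — four exponential bounds, context-free — is extracted as the public lemma `thr_le_exp_quartic` in §3c with the local abbreviations passed as variables and the defining equation of c_T as a hypothesis; K2's STATEMENT byte-identical, all 87 K decl signatures identical, +1 decl; farm rc 0 · 0/0/0 · axioms std on K2): 01 = §1 Lipschitz (`FrelC`, `lam`, `lipschitz_Frel₂_explicit`) + §2 root avoidance (`fibreSum_ne_zero`); 02 = §3 K1 `thr`, `bigTheta`, `thrP`, **`twoRadical_lower`**; 03 = §3b outer upper half (`norm_normForm_le`, `normForm_len_le`); 04 = §3c `thr_le`, `thr_le_exp_quartic` (cap lemma) + §4 classes `UltraLiouvilleSW` / `TowerLiouville` («[class] definition» tags) + `thr_nonneg` + §5 prelude `thetaS`; 05 = §5 K2 **`algebraicIndependent_product`**;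 06 = §6 law `sw`, members `ultraLiouvilleSW_rhoU` (tree rhoU), `gT`/`vT`/`tTerm`/`rhoT`/`tNum`/`tRat`, `towerLiouville_rhoT`; 07 = §7 cells `algebraicIndependent_eight_of_pos`, `eight_le_polarDeg_one_pair`, `six_le_polarDeg_one_pair`, `schanuel_body_one_pair`, `six_le_polarDeg_pair`, `four_le_polarDeg_pair`, `schanuel_body_pair`, named pair (ρ_U, ρ_T) hyp-free; 08 = §8 `E₅`, `thrP_le_exp`, `transcMeasure_thetaS`, `transcMeasure_rhoU`. PORT EDITS (VERDICT L2407 (a)–(d) + the cap edition): linter option dropped; 26 one-line docstrings added; class tags in the census wording; scoped heartbeats kept `… in` (1600000 ×2, 800000 ×1 as in K); per-part private helper copies; statements and proofs otherwise verbatim (no renames). `--supports stmt-Schanuel-24622`; no census credit carried; rung 0 — nothing here proves Schanuel; no ∀-item moves.)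
-/

noncomputable section
open Complex
namespace Summit.Schanuel.Schanuel.Theorems.RootDecomp1BProductCell
open MvPolynomial
open Summit.Schanuel.Schanuel.Theorems.RootDecomp1KHyper (mvlen mvlen_nonneg one_le_mvlen abs_coeff_le_mvlen)
open RootDecomp1BRadicalDescent (resFin DExpMeasure UltraLiouville exists_int_relation norm_mvaeval_le_mvlen
  totalDegree_det_le mvlen_det_le adjugate_bounds)
open RootDecomp1BTwoRadical (sX₃ sX₃_apply eq_of_parts₃ Cf₂ Frel₂ Frel₂_eq_aeval radMat₂ det_radMat₂_ne_zero
  det_eq_eigen_mul₂ eigen_eq_Frel₂ mvlen_radMat₂_le totalDegree_radMat₂_le mvlen_Cf₂_le twoRadical_clash)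
variable {n : ℕ}

/-! ## §6 THE STANDARD WAITING LAW `sw` AND THE TWO NAMED MEMBERS `ρ_U ∈ 𝒜_sw`, `ρ_T ∈ ℬ_sw` (hypothesis-free)

`sw Q = 2^{4·3^{3^{Q²}}}` is the growth law of the tree tower `uTow` (`u (k+1) = 4·3^{3^{(k+1)·u k}}`): the tree member
`ρ_U = Σ 2^{-u_k}` (`RootDecomp1BRadicalDescent.rhoU`, g33) WAITS at most `sw`, i.e. `ρ_U ∈ UltraLiouvilleSW sw`
(`ultraLiouvilleSW_rhoU`); and the new member `ρ_T = Σ 2^{-v_k}` with `v (k+1) = 2·gT k (2^{v k}) + 2 + v k`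
OUT-WAITS `sw`, i.e. `ρ_T ∈ TowerLiouville sw` (`towerLiouville_rhoT`).  The two constructions never refer to each
other: `vT` mentions `sw` only (the law), never `uTow` or `ρ_U`. -/

section Members

open Finset
open RootDecomp1BRadicalDescent (uTow uTow_succ uTow_lt_succ uTow_strictMono le_uTow uTerm rhoU uRat uRat_den
  rhoU_sub_uRat tail_pos tail_le tail_lt_threshold rhoU_pos)

/-- **[class] definition (the law).** The STANDARD WAITING LAW `sw Q = 2^{4·3^{3^{Q·Q}}}`. -/
def sw (Q : ℕ) : ℕ := 2 ^ (4 * 3 ^ (3 ^ (Q * Q)))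

/-- `Q ≤ sw Q`. -/
theorem le_sw (Q : ℕ) : Q ≤ sw Q := by
  unfold sw
  have h1 : Q ≤ 3 ^ (Q * Q) := by
    rcases Nat.eq_zero_or_pos Q with h | h
    · simp [h]
    · calc Q ≤ Q * Q := Nat.le_mul_of_pos_left Q h
        _ ≤ 3 ^ (Q * Q) := (Nat.lt_pow_self (by norm_num)).le
  have h2 : 3 ^ (Q * Q) ≤ 3 ^ (3 ^ (Q * Q)) := Nat.pow_le_pow_right (by norm_num) (Nat.lt_pow_self (by norm_num)).le
  calc Q ≤ 2 ^ Q := Nat.lt_two_pow_self.le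
    _ ≤ 2 ^ (4 * 3 ^ (3 ^ (Q * Q))) := Nat.pow_le_pow_right (by norm_num) (by omega)

/-- `sw` is monotone. -/
theorem sw_mono : Monotone sw := fun a b h =>
  Nat.pow_le_pow_right (by norm_num) (Nat.mul_le_mul_left 4
    (Nat.pow_le_pow_right (by norm_num) (Nat.pow_le_pow_right (by norm_num) (Nat.mul_le_mul h h))))

/-- **THE TREE MEMBER `ρ_U` WAITS AT MOST `sw`: `ρ_U ∈ UltraLiouvilleSW sw`** — HYPOTHESIS-FREE.  (At threshold `Q`
take the FIRST partial sum `uRat K` with `2^{u_K} ≥ Q`; minimality gives `2^{u_{K-1}} < Q`, whence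
`u_K = 4·3^{3^{K·u_{K-1}}} ≤ 4·3^{3^{Q·Q}}`, i.e. `den = 2^{u_K} ≤ sw Q`; the rate is the tree's `tail_lt_threshold`.) -/
theorem ultraLiouvilleSW_rhoU : UltraLiouvilleSW sw rhoU := by
  intro m
  refine ⟨2 ^ uTow m + 1, fun Q hQ => ?_⟩
  have hex : ∃ k, Q ≤ 2 ^ uTow k := ⟨Q, (le_uTow Q).trans Nat.lt_two_pow_self.le⟩
  classical
  have hKQ : Q ≤ 2 ^ uTow (Nat.find hex) := Nat.find_spec hex
  have hKmin : ∀ k, k < Nat.find hex → ¬ Q ≤ 2 ^ uTow k := fun k hk => Nat.find_min hex hk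
  set K := Nat.find hex with hK
  have hmK : m < K := by
    by_contra h
    push Not at h
    have h1 : uTow K ≤ uTow m := uTow_strictMono.monotone h
    have h2 : 2 ^ uTow K ≤ 2 ^ uTow m := Nat.pow_le_pow_right (by norm_num) h1
    omega
  obtain ⟨K', hK'⟩ : ∃ K', K = K' + 1 := Nat.exists_eq_add_one_of_ne_zero (by omega)
  have hlt : 2 ^ uTow K' < Q := by
    have := hKmin K' (by omega)
    omega
  have huQ : uTow K' < Q := Nat.lt_two_pow_self.trans hlt
  have hprod : (K' + 1) * uTow K' ≤ Q * Q := Nat.mul_le_mul (by have := le_uTow K'; omega) huQ.le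
  have hden : (uRat K).den ≤ sw Q := by
    rw [uRat_den, hK', uTow_succ]
    unfold sw
    exact Nat.pow_le_pow_right (by norm_num) (Nat.mul_le_mul_left 4
      (Nat.pow_le_pow_right (by norm_num) (Nat.pow_le_pow_right (by norm_num) hprod)))
  have htail : rhoU - (uRat K : ℝ) = ∑' j, uTerm (j + (K + 1)) := rhoU_sub_uRat K
  have hpos : 0 < rhoU - (uRat K : ℝ) := by rw [htail]; exact tail_pos K
  refine ⟨uRat K, by rw [uRat_den]; exact hKQ, hden, fun h => ?_, ?_⟩
  · rw [h, sub_self] at hpos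
    exact lt_irrefl _ hpos
  · rw [abs_of_pos hpos, htail, uRat_den]
    refine ((tail_le K).trans_lt (tail_lt_threshold K)).trans_le
      (Real.exp_le_exp.2 (neg_le_neg (Real.exp_le_exp.2 ?_)))
    have h1 : (1 : ℝ) ≤ (((2 ^ uTow K : ℕ) : ℕ) : ℝ) := by exact_mod_cast Nat.one_le_two_pow
    exact pow_le_pow_right₀ h1 hmK.le

/-- the GAP FUNCTION of the tower law: `gT k d = d^k + ⌈exp(((sw ⌈exp(d^k)⌉)²)^k)⌉`, a natural majorant of the
exponent demanded by `TowerLiouville sw` at order `k` and denominator `d`. -/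
def gT (k d : ℕ) : ℕ := d ^ k + ⌈Real.exp (((((sw ⌈Real.exp (((d : ℕ) : ℝ) ^ k)⌉₊ : ℕ) : ℝ)) ^ 2) ^ k)⌉₊

/-- **[class] data — the tower exponents** `v 0 = 1`, `v (k+1) = 2·gT k (2^{v k}) + 2 + v k`. -/
def vT : ℕ → ℕ
  | 0 => 1
  | k + 1 => 2 * gT k (2 ^ vT k) + 2 + vT k

/-- `v (k+1) = 2·gT k (2^{v k}) + 2 + v k`. -/
theorem vT_succ (k : ℕ) : vT (k + 1) = 2 * gT k (2 ^ vT k) + 2 + vT k := rfl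

/-- `v k < v (k+1)`. -/
theorem vT_lt_succ (k : ℕ) : vT k < vT (k + 1) := by rw [vT_succ]; omega

/-- `vT` is strictly monotone. -/
theorem vT_strictMono : StrictMono vT := strictMono_nat_of_lt_succ vT_lt_succ

/-- `k ≤ v k`. -/
theorem le_vT (k : ℕ) : k ≤ vT k := by
  induction k with
  | zero => simp [vT]
  | succ k ih => have := vT_lt_succ k; omega

/-- `v (K+1) + j ≤ v (j + K + 1)`. -/
theorem vT_add_le (K j : ℕ) : vT (K + 1) + j ≤ vT (j + (K + 1)) := by
  induction j with
  | zero => simp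
  | succ j ih =>
    have := vT_lt_succ (j + (K + 1))
    rw [show j + 1 + (K + 1) = j + (K + 1) + 1 by ring]
    omega

/-- the terms `2^{-v_k}` -/
def tTerm (k : ℕ) : ℝ := ((1 : ℝ) / 2) ^ vT k

/-- The tower terms are positive. -/
theorem tTerm_pos (k : ℕ) : 0 < tTerm k := by unfold tTerm; positivity

/-- The tower terms are dominated by the geometric series `(1/2)^k`. -/
theorem tTerm_le_geom (k : ℕ) : tTerm k ≤ ((1 : ℝ) / 2) ^ k :=
  pow_le_pow_of_le_one (by norm_num) (by norm_num) (le_vT k)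

/-- The tower series is summable. -/
theorem summable_tTerm : Summable tTerm :=
  Summable.of_nonneg_of_le (fun k => (tTerm_pos k).le) tTerm_le_geom summable_geometric_two

/-- **`ρ_T := Σ_k 2^{-v_k}`**, the named TOWER-LIOUVILLE member (out-waits `sw`). -/
def rhoT : ℝ := ∑' k, tTerm k

/-- numerator of the `K`-th partial sum: `Σ_{k ≤ K} 2^{v_K − v_k}` (odd). -/
def tNum (K : ℕ) : ℕ := ∑ k ∈ range (K + 1), 2 ^ (vT K - vT k)

/-- the `K`-th partial sum as a rational `tNum K / 2^{v_K}`. -/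
def tRat (K : ℕ) : ℚ := (tNum K : ℚ) / 2 ^ vT K

/-- The partial sums of the tower series are the rationals `tRat K`. -/
theorem sum_tTerm_eq (K : ℕ) : ∑ k ∈ range (K + 1), tTerm k = ((tRat K : ℚ) : ℝ) := by
  unfold tRat tNum tTerm
  push_cast
  rw [Finset.sum_div]
  refine Finset.sum_congr rfl fun k hk => ?_
  have hk' : vT k ≤ vT K := vT_strictMono.monotone (Nat.lt_succ_iff.mp (mem_range.mp hk))
  rw [one_div_pow, pow_sub₀ (2 : ℝ) two_ne_zero hk']
  field_simp

/-- The numerators `tNum K` are odd (lowest terms). -/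
theorem tNum_odd (K : ℕ) : Odd (tNum K) := by
  unfold tNum
  rw [Finset.sum_range_succ, Nat.sub_self, pow_zero]
  have hdvd : 2 ∣ ∑ k ∈ range K, 2 ^ (vT K - vT k) := by
    refine Finset.dvd_sum fun k hk => ?_
    have hk' : vT k < vT K := vT_strictMono (mem_range.mp hk)
    rw [show vT K - vT k = (vT K - vT k - 1) + 1 by omega, pow_succ]
    exact dvd_mul_left 2 _
  obtain ⟨c, hc⟩ := hdvd
  exact ⟨c, by rw [hc]⟩

/-- The `K`-th partial sum has denominator exactly `2^{v_K}`. -/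
theorem tRat_den (K : ℕ) : (tRat K).den = 2 ^ vT K := by
  have hcop : Nat.Coprime (tNum K) (2 ^ vT K) := Nat.Coprime.pow_right _ (tNum_odd K).coprime_two_right
  have h := Rat.den_div_eq_of_coprime (a := (tNum K : ℤ)) (b := ((2 ^ vT K : ℕ) : ℤ))
    (by positivity) (by simpa using hcop)
  have hq : ((tNum K : ℤ) : ℚ) / (((2 ^ vT K : ℕ) : ℤ) : ℚ) = tRat K := by
    unfold tRat; push_cast; rfl
  rw [hq] at h
  exact_mod_cast h

/-- Shifted summability of the tower series. -/
theorem summable_tTerm_shift (K : ℕ) : Summable fun j : ℕ => tTerm (j + (K + 1)) :=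
  (summable_nat_add_iff (K + 1)).mpr summable_tTerm

/-- `ρ_T − tRat K` is the tail of the tower series. -/
theorem rhoT_sub_tRat (K : ℕ) : rhoT - (tRat K : ℝ) = ∑' j, tTerm (j + (K + 1)) := by
  rw [← sum_tTerm_eq, rhoT, ← summable_tTerm.sum_add_tsum_nat_add (K + 1)]
  ring

/-- The tail is positive. -/
theorem tailT_pos (K : ℕ) : 0 < ∑' j, tTerm (j + (K + 1)) :=
  (summable_tTerm_shift K).tsum_pos (fun _ => (tTerm_pos _).le) 0 (tTerm_pos _)

/-- The tail is at most twice its first term. -/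
theorem tailT_le (K : ℕ) : ∑' j, tTerm (j + (K + 1)) ≤ ((1 : ℝ) / 2) ^ vT (K + 1) * 2 := by
  have hg : Summable fun j : ℕ => ((1 : ℝ) / 2) ^ vT (K + 1) * ((1 : ℝ) / 2) ^ j :=
    summable_geometric_two.mul_left _
  calc ∑' j, tTerm (j + (K + 1)) ≤ ∑' j : ℕ, ((1 : ℝ) / 2) ^ vT (K + 1) * ((1 : ℝ) / 2) ^ j :=
        (summable_tTerm_shift K).tsum_le_tsum (fun j => by
          unfold tTerm
          rw [← pow_add]
          exact pow_le_pow_of_le_one (by norm_num) (by norm_num) (vT_add_le K j)) hg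
    _ = ((1 : ℝ) / 2) ^ vT (K + 1) * 2 := by
        rw [summable_geometric_two.tsum_mul_left, tsum_geometric_two]

/-- `ρ_T > 0`. -/
theorem rhoT_pos : 0 < rhoT :=
  summable_tTerm.tsum_pos (fun k => (tTerm_pos k).le) 0 (tTerm_pos 0)

/-- **THE NAMED MEMBER `ρ_T` OUT-WAITS `sw`: `ρ_T ∈ TowerLiouville sw`** — HYPOTHESIS-FREE.  At order `m` the
approximant is the `m`-th partial sum (denominator `d = 2^{v_m} ≥ m`), and the tail `≤ 2·2^{-v_{m+1}}` with
`v_{m+1} = 2·gT m d + 2 + v_m` is below `(1/4)^{gT m d} ≤ e^{-gT m d} ≤ exp(−(d^m + exp(((sw ⌈exp(d^m)⌉)²)^m)))`. -/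
theorem towerLiouville_rhoT : TowerLiouville sw rhoT := by
  intro m
  have htail := rhoT_sub_tRat m
  have hpos : 0 < rhoT - (tRat m : ℝ) := by rw [htail]; exact tailT_pos m
  refine ⟨tRat m, ?_, ?_, ?_⟩
  · rw [tRat_den]
    exact (le_vT m).trans Nat.lt_two_pow_self.le
  · intro h
    rw [h, sub_self] at hpos
    exact lt_irrefl _ hpos
  · rw [abs_of_pos hpos, htail, tRat_den]
    refine (tailT_le m).trans_lt ?_
    have hGc : (((2 ^ vT m : ℕ) : ℝ)) ^ m +
        Real.exp (((((sw ⌈Real.exp ((((2 ^ vT m : ℕ) : ℝ)) ^ m)⌉₊ : ℕ) : ℝ)) ^ 2) ^ m) ≤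
        ((gT m (2 ^ vT m) : ℕ) : ℝ) := by
      unfold gT
      push_cast
      exact add_le_add le_rfl (Nat.le_ceil _)
    have h14 : (1 : ℝ) / 4 ≤ Real.exp (-1) := by
      rw [Real.exp_neg, one_div]
      exact inv_anti₀ (Real.exp_pos 1) (Real.exp_one_lt_d9.le.trans (by norm_num))
    have hG0 : (0 : ℝ) < ((1 : ℝ) / 4) ^ gT m (2 ^ vT m) := by positivity
    rw [vT_succ]
    calc ((1 : ℝ) / 2) ^ (2 * gT m (2 ^ vT m) + 2 + vT m) * 2
        ≤ ((1 : ℝ) / 2) ^ (2 * gT m (2 ^ vT m) + 2) * 2 :=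
          mul_le_mul_of_nonneg_right (pow_le_pow_of_le_one (by norm_num) (by norm_num) (by omega)) (by norm_num)
      _ = ((1 : ℝ) / 4) ^ gT m (2 ^ vT m) * (1 / 2) := by
          rw [pow_add, pow_mul]
          norm_num
          ring
      _ < ((1 : ℝ) / 4) ^ gT m (2 ^ vT m) := by linarith
      _ ≤ Real.exp (-1) ^ gT m (2 ^ vT m) := pow_le_pow_left₀ (by norm_num) h14 _
      _ = Real.exp (-((gT m (2 ^ vT m) : ℕ) : ℝ)) := by
          rw [← Real.exp_nat_mul]
          congr 1
          ring
      _ ≤ _ := Real.exp_le_exp.2 (neg_le_neg hGc)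

/-- `ρ_U ∈ UltraLiouville` read back through the new class (consistency with the tree's `ultraLiouville_rhoU`). -/
example : UltraLiouville rhoU := ultraLiouvilleSW_rhoU.ultraLiouville

/-- `ρ_T` is ultra-Liouville (tree class). -/
theorem ultraLiouville_rhoT : UltraLiouville rhoT := towerLiouville_rhoT.ultraLiouville le_sw

end Members

end Summit.Schanuel.Schanuel.Theorems.RootDecomp1BProductCell

end
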